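/-
Copyright (c) 2026 the pub-hodgecm-mathlib formalisation cell (harness21).  Prover seat hodgecm-mathlib-LH4-p01 (g4), 2026-09-02: «ABSTRACT WILD MARS INDEX» — the unit index of the
conductor orders of a totally ramified quadratic extension of discrete valuation rings with involution, ANY residue characteristic (LH4-plan (g5) WORD #30 (2) ∕ #36 (o1)).
-/
import Literature.NumberTheory.LocalFields.RamifiedQuadraticOrderUnitIndex   -- ★ (F3b) tame: `exists_fixed_add_fixed_mul`, `natCard_map_mk_maximalIdeal_pow`; brings ★ (F3a) `mem_comap_eqLocus_iff`, `maximalIdeal_pow_le_comap`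
import HarnessLib

/-!
# The RAMIFIED quadratic order unit index at ANY residue characteristic: `[Sˣ : {u : σu ≡ u (𝔪^{d+2j})}] = q^j` — Mars' index `[R_E^× : R_E(j)^×]` for `e = 2`, wild or tame
# (Flicker 1998, Prop. 7 p. 84, §6 p. 95 REMARK; Serre, *Local Fields* Ch. IV §1, Ch. V §1)

Topic `NumberTheory/LocalFields`, namespace `Literature.NumberTheory.LocalFields.RamifiedQuadraticOrder` (= ★ `RamifiedQuadraticOrderUnitIndex`).  THEOREMS ONLY: no definition,
no named fact, no instance, no notation, no `sorry`.  Cell `pub/hodgecm-mathlib`, crux H413 = `stmt-HodgeConjecture-24833`; half A line LH4, wild base layer (LH4-plan (g5) WORD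
#30 (2) ∕ #36 ∕ #38, offer (o1) of LH4-p01 (g4)).  HONEST READER LABEL: banked base layer — NO LIVE READER; the intended first consumer is the unit-index input of the wild
type-(2) torus weights `[𝒪_{K₂}ˣ : (𝒪_w + 𝔭_w^j 𝒪_{K₂})ˣ]` for a WILDLY RAMIFIED rank-2 splitting field `K₂ ∕ L_w` (F0P3a-p06 (g17) DUNR-H2-CENSUS §1 M4; (D-UNR)∕(D-RAM) are PRINT
organs by ruling D74′), a frame with its own involution that is NOT a CM place — so the CM-place instance ★ `RamifiedPlaceOrderUnitIndex` (p851113, valuation letters) does not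
serve it, while this abstract file does.  Count-neutral; HC_CM is proved only modulo the 7 printed citations (2 remaining named inputs: hLiu418 = stmt-HodgeConjecture-24832,
h413 = stmt-HodgeConjecture-24833) until rung 0 closes.

THE FRAME (strict generalisation of ★ `RamifiedQuadraticOrderUnitIndex`).  `S` a DVR (`[IsDomain S] [IsDiscreteValuationRing S]`) with residue field `𝓀`, `|𝓀| = q`;
`σ : S →+* S` an involution (`hσ : σσ = id`); `τ` a uniformiser (`hτ : Irreducible τ`); the EISENSTEIN BASIS over the fixed ring
`hbasis : ∀ x, ∃ a b, σ a = a ∧ σ b = b ∧ x = a + b * τ` (`S = S^σ ⊕ S^σ·τ` — every totally ramified quadratic extension of complete DVRs); and the DIFFERENT EXPONENT `d` as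
the ideal equation `hd : Ideal.span {σ τ − τ} = 𝔪^d`.  The tame file's tokens (`hres`, anti-fixed `σϖ = −ϖ`, `h2 : IsUnit 2`) give this frame with `τ := ϖ`, `d := 1`
(`hbasis` = ★ `exists_fixed_add_fixed_mul`, `(σϖ − ϖ) = (−2ϖ) = 𝔪`), and ★'s HEAD is re-derived below (`index_comap_eqLocus_odd_eq_pow'`); conversely a wild place has no skew
uniformiser when `d` is even (★ `RamifiedPlaceDifferent.exists_skew_uniformizer_iff`).  The subgroups are ★ (F3a)'s `comap eqLocus` groups
`V_k = {u ∈ Sˣ : σu − u ∈ 𝔪^k}` (★ `mem_comap_eqLocus_iff`); in coordinates `V_{d+2j} = (S^σ + (τστ)^j S)ˣ` (`map_sub_self_mem_pow_add_iff`), Flicker's `R_E(j)^×`.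

THE MATHEMATICS.  (§1) Coordinates over the fixed ring are unique (`στ ≠ τ`); `σx − x = b·(στ − τ)`, so **`σx − x ∈ 𝔪^{d+k} ↔ b ∈ 𝔪^k`** and every depth `≤ d` is automatic;
`τ² = −τστ + (τ + στ)τ` with `τ + στ ∈ 𝔪`, `(τστ) = 𝔪²`; and the key lemma **FIXED ELEMENTS HAVE EVEN ORDER** (`mem_pow_succ_of_fixed_of_mem_pow_odd`) WITHOUT `2 ∈ Sˣ`: a fixed
`c = τw ∈ 𝔪`, `w = a + b′τ`, satisfies `(στ − τ)(a + b′(τ + στ)) = 0`, so `a ∈ 𝔪` and `c ∈ 𝔪²`.  (§2) For `u = a + bτ ∈ V_{d+2j}` (`b ∈ 𝔪^{2j}`, `a ∈ Sˣ`) the `τ`-COORDINATE RATIO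
`u ↦ b·a⁻¹ mod 𝔪^{2j+1}` is additive (`ratio_mul_sub_add_mem`: after clearing denominators the defect is `bb′((τ+στ)aa′ + (ba′ + b′a)τστ) ∈ 𝔪^{2j}·𝔪`), ONTO `𝔪^{2j}∕𝔪^{2j+1} ≅ 𝓀`
(`1 + (τστ)^j r₀·τ`, `r₀` the fixed coordinate of `r`), with KERNEL `{b ∈ 𝔪^{2j+1}} = {b ∈ 𝔪^{2j+2}} = V_{d+2j+2}` (even order), whence **`[V_{d+2j} : V_{d+2j+2}] = q`**
(`relIndex_comap_eqLocus_add_two`) and NO ODD STEPS `V_{d+2j+1} = V_{d+2j+2}` (`map_sub_self_mem_pow_add_odd_iff`).  (§3) Induction: **`[Sˣ : V_{d+2j}] = q^j`** (HEAD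
`index_comap_eqLocus_add_two_mul_eq_pow`), odd levels `[Sˣ : V_{d+2j+1}] = q^{j+1}`, and the tame corollary.  (The CM-place file ★ p851113 runs the same graded argument in
valuation letters with the residue-field-valued ratio `b ∕ (ϖ_v^j a)`; here the target is `𝔪^{2j}∕𝔪^{2j+1}` as in ★ tame §3, counted by ★ `natCard_map_mk_maximalIdeal_pow`.)

* §1 `map_ne_self_of_span_eq_pow`, `fixed_coords_unique'`, `map_sub_self_eq_mul_of_coords`, `map_add_map_self_eq`, `sq_eq_trace_mul_sub_norm`, `mem_maximalIdeal_of_irreducible'`,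
  `map_uniformizer_mem_maximalIdeal`, `trace_mem_maximalIdeal`, `irreducible_map`, `span_mul_map_eq_sq`, `maximalIdeal_pow_two_mul`, `mul_map_sub_self_mem_pow_add_iff`,
  **`map_sub_self_mem_pow_add_iff`**, `map_sub_self_mem_pow_different`, `mem_sq_of_fixed_of_mem`, **`mem_pow_succ_of_fixed_of_mem_pow_odd`**, `isUnit_of_isUnit_add_mul`,
  `coords_mul`, `ratio_mul_sub_add_mem`.
* §2 `map_sub_self_mem_pow_add_odd_iff`, `index_comap_eqLocus_eq_one_of_le`, **`relIndex_comap_eqLocus_add_two`**.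
* §3 **`index_comap_eqLocus_add_two_mul_eq_pow`** (HEAD), `index_comap_eqLocus_add_odd_eq_pow`, `index_comap_eqLocus_odd_eq_pow'` (the tame ★ as a corollary).

## References
* [Flicker1998UnitaryFL] Y. Z. Flicker, *Elementary proof of the fundamental lemma for a unitary group*, Canad. J. Math. 50 (1998), Prop. 7 p. 84, §6 p. 95 REMARK (Mars:
  `[R_E^× : R_E(j)^×] = q^{j+1−f}(q^f − 1)∕(q − 1)`).
* [Serre1979] J.-P. Serre, *Local Fields*, GTM 67 (1979), Ch. I §6 Prop. 18 (Eisenstein basis), Ch. IV §1 Prop. 3–4 (`i_G(σ) = ord(στ − τ)`), Ch. V §1 (the filtration `U^{(n)}`).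
-/

set_option autoImplicit false

namespace Literature.NumberTheory.LocalFields.RamifiedQuadraticOrder

open IsLocalRing Literature.NumberTheory.LocalFields.UnramifiedQuadraticNorm

universe u

variable {S : Type u} [CommRing S] (σ : S →+* S)

/-! ## §1 The Eisenstein basis over the fixed ring: coordinates, `τ² = c₀ + c₁τ`, `σx − x = b·(στ − τ)`, fixed elements have even order -/

section Structure

variable [IsDomain S] [IsDiscreteValuationRing S] (hσ : ∀ x, σ (σ x) = x) {τ : S} (hτ : Irreducible τ)
  (hbasis : ∀ x : S, ∃ a b : S, σ a = a ∧ σ b = b ∧ x = a + b * τ) {d : ℕ} (hd : Ideal.span {σ τ - τ} = maximalIdeal S ^ d)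

include hτ hd in
/-- `στ ≠ τ` (the different `(στ − τ) = 𝔪^d` is non-zero). [cite: Serre1979, Ch. IV §1 Prop. 4] -/
theorem map_ne_self_of_span_eq_pow : σ τ ≠ τ := by
  intro h
  have h0 : Ideal.span {σ τ - τ} = ⊥ := by rw [h, sub_self, Ideal.span_singleton_eq_bot]
  rw [hd] at h0
  exact pow_ne_zero d (by
    rw [Ne, Ideal.zero_eq_bot, (IsDiscreteValuationRing.irreducible_iff_uniformizer τ).1 hτ, Ideal.span_singleton_eq_bot]; exact hτ.ne_zero) h0

include hτ hd in
/-- **UNIQUENESS OF COORDINATES** over the fixed ring: `a + bτ = a′ + b′τ` with all four `σ`-fixed forces `a = a′`, `b = b′` (apply `σ` and subtract: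
`(b − b′)(τ − στ) = 0`).  No `2 ∈ Sˣ` needed. [cite: Serre1979, Ch. I §6 Prop. 18] -/
theorem fixed_coords_unique' {a b a' b' : S} (ha : σ a = a) (hb : σ b = b) (ha' : σ a' = a') (hb' : σ b' = b')
    (h : a + b * τ = a' + b' * τ) : a = a' ∧ b = b' := by
  have hσh : a + b * σ τ = a' + b' * σ τ := by
    have := congrArg σ h
    rwa [map_add, map_add, map_mul, map_mul, ha, hb, ha', hb'] at this
  have hbb : b = b' := by
    have h3 : (b - b') * (σ τ - τ) = 0 := by linear_combination hσh - h
    rcases mul_eq_zero.1 h3 with h4 | h4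
    · exact sub_eq_zero.1 h4
    · exact absurd (sub_eq_zero.1 h4) (map_ne_self_of_span_eq_pow σ hτ hd)
  refine ⟨?_, hbb⟩
  rw [hbb] at h
  exact add_right_cancel h

omit [IsDomain S] [IsDiscreteValuationRing S] in
/-- `σx − x = b·(στ − τ)` for `x = a + bτ` with `a, b` fixed. [cite: Serre1979, Ch. IV §1] -/
theorem map_sub_self_eq_mul_of_coords {x a b : S} (ha : σ a = a) (hb : σ b = b) (h : x = a + b * τ) : σ x - x = b * (σ τ - τ) := by
  rw [h, map_add, map_mul, ha, hb]; ring

omit [IsDomain S] [IsDiscreteValuationRing S] in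
include hσ in
/-- **`τ + στ` and `τ·στ` are fixed** (`σσ = 1`). [cite: Serre1979, Ch. I §6 Prop. 18] -/
theorem map_add_map_self_eq : σ (τ + σ τ) = τ + σ τ ∧ σ (τ * σ τ) = τ * σ τ := by
  constructor
  · rw [map_add, hσ, add_comm]
  · rw [map_mul, hσ, mul_comm]

omit [IsDomain S] [IsDiscreteValuationRing S] in
/-- `τ² = −(τ·στ) + (τ + στ)·τ` — the Eisenstein relation, with FIXED coefficients `c₀ = −τ·στ`, `c₁ = τ + στ`. [cite: Serre1979, Ch. I §6 Prop. 18] -/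
theorem sq_eq_trace_mul_sub_norm : τ ^ 2 = -(τ * σ τ) + (τ + σ τ) * τ := by ring

include hτ in
/-- A uniformiser lies in `𝔪`. [cite: Serre1979, Ch. I §6] -/
theorem mem_maximalIdeal_of_irreducible' : τ ∈ maximalIdeal S := by
  rw [(IsDiscreteValuationRing.irreducible_iff_uniformizer τ).1 hτ]; exact Ideal.mem_span_singleton_self τ

include hσ hτ in
/-- `στ ∈ 𝔪` (★ `UnramifiedQuadraticNorm.map_mem_maximalIdeal`: an involution preserves `𝔪`). [cite: Serre1979, Ch. V §1] -/
theorem map_uniformizer_mem_maximalIdeal : σ τ ∈ maximalIdeal S :=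
  UnramifiedQuadraticNorm.map_mem_maximalIdeal σ hσ τ (mem_maximalIdeal_of_irreducible' hτ)

include hσ hτ in
/-- The trace `τ + στ` lies in `𝔪` (both summands do). [cite: Serre1979, Ch. I §6 Prop. 18] -/
theorem trace_mem_maximalIdeal : τ + σ τ ∈ maximalIdeal S :=
  add_mem (mem_maximalIdeal_of_irreducible' hτ) (map_uniformizer_mem_maximalIdeal σ hσ hτ)

omit [IsDomain S] [IsDiscreteValuationRing S] in
include hσ hτ in
/-- `στ` is irreducible (`σ` is a ring automorphism, `σσ = 1`). [cite: Serre1979, Ch. I §6] -/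
theorem irreducible_map : Irreducible (σ τ) := by
  have hbij : Function.Bijective σ := Function.bijective_iff_has_inverse.2 ⟨σ, hσ, hσ⟩
  exact (MulEquiv.irreducible_iff (RingEquiv.ofBijective σ hbij).toMulEquiv).2 hτ

include hσ hτ in
/-- **`(τ·στ) = 𝔪²`**: the norm `N = τ·στ` generates the square of the maximal ideal (`στ` is a uniformiser too). [cite: Serre1979, Ch. I §6 Prop. 18] -/
theorem span_mul_map_eq_sq : Ideal.span {τ * σ τ} = maximalIdeal S ^ 2 := by
  have hmax : maximalIdeal S = Ideal.span {τ} := (IsDiscreteValuationRing.irreducible_iff_uniformizer τ).1 hτ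
  have hmax' : maximalIdeal S = Ideal.span {σ τ} := (IsDiscreteValuationRing.irreducible_iff_uniformizer (σ τ)).1 (irreducible_map σ hσ hτ)
  rw [sq, ← Ideal.span_singleton_mul_span_singleton, ← hmax, ← hmax']

include hσ hτ in
/-- `𝔪^{2i} = ((τ·στ)^i)`. [cite: Serre1979, Ch. I §6] -/
theorem maximalIdeal_pow_two_mul (i : ℕ) : maximalIdeal S ^ (2 * i) = Ideal.span {(τ * σ τ) ^ i} := by
  rw [pow_mul, ← span_mul_map_eq_sq σ hσ hτ, Ideal.span_singleton_pow]

include hτ hd in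
/-- **`b·(στ − τ) ∈ 𝔪^{d+k} ↔ b ∈ 𝔪^k`** — the different `(στ − τ) = 𝔪^d` shifts depths by exactly `d`. [cite: Serre1979, Ch. IV §1 Prop. 4] -/
theorem mul_map_sub_self_mem_pow_add_iff (b : S) (k : ℕ) : b * (σ τ - τ) ∈ maximalIdeal S ^ (d + k) ↔ b ∈ maximalIdeal S ^ k := by
  have hδ : σ τ - τ ≠ 0 := sub_ne_zero.2 (map_ne_self_of_span_eq_pow σ hτ hd)
  rw [pow_add, ← hd, mul_comm (Ideal.span _) _, Ideal.mem_mul_span_singleton]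
  constructor
  · rintro ⟨z, hz, hzb⟩
    rwa [← mul_right_cancel₀ hδ hzb]
  · intro hb; exact ⟨b, hb, rfl⟩

include hτ hd in
/-- **DEPTH IN COORDINATES**: for `x = a + bτ` (`a, b` fixed), `σx − x ∈ 𝔪^{d+k} ↔ b ∈ 𝔪^k`. [cite: Serre1979, Ch. IV §1 Prop. 4] -/
theorem map_sub_self_mem_pow_add_iff {x a b : S} (ha : σ a = a) (hb : σ b = b) (h : x = a + b * τ) (k : ℕ) :
    σ x - x ∈ maximalIdeal S ^ (d + k) ↔ b ∈ maximalIdeal S ^ k := by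
  rw [map_sub_self_eq_mul_of_coords σ ha hb h, mul_map_sub_self_mem_pow_add_iff σ hτ hd b k]

include hτ hbasis hd in
/-- Depths `≤ d` are automatic: `σx − x ∈ 𝔪^d` for EVERY `x ∈ S` (`σ ≡ id (mod 𝔪^d)`). [cite: Serre1979, Ch. IV §1 Prop. 4] -/
theorem map_sub_self_mem_pow_different (x : S) : σ x - x ∈ maximalIdeal S ^ d := by
  obtain ⟨a, b, ha, hb, hx⟩ := hbasis x
  have := (map_sub_self_mem_pow_add_iff σ hτ hd ha hb hx 0).2 (by rw [pow_zero, Ideal.one_eq_top]; exact Submodule.mem_top)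
  rwa [add_zero] at this

include hσ hτ hbasis hd in
/-- **A FIXED ELEMENT OF `𝔪` LIES IN `𝔪²`** (no `2 ∈ Sˣ` needed): if `σc = c` and `c = τ·w`, write `w = a + b′τ`; then `σc = c` gives `(στ − τ)(a + b′(τ + στ)) = 0`, so
`a = −b′(τ + στ) ∈ 𝔪`, `w ∈ 𝔪`, `c ∈ 𝔪²`. [cite: Serre1979, Ch. IV §1 Prop. 3] -/
theorem mem_sq_of_fixed_of_mem {c : S} (hc : σ c = c) (hcm : c ∈ maximalIdeal S) : c ∈ maximalIdeal S ^ 2 := by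
  have hmax : maximalIdeal S = Ideal.span {τ} := (IsDiscreteValuationRing.irreducible_iff_uniformizer τ).1 hτ
  rw [hmax, Ideal.mem_span_singleton'] at hcm
  obtain ⟨w, rfl⟩ := hcm
  obtain ⟨a, b', ha, hb', hw⟩ := hbasis w
  have hδ : σ τ - τ ≠ 0 := sub_ne_zero.2 (map_ne_self_of_span_eq_pow σ hτ hd)
  -- `σ(wτ) = wτ` ⇒ `(στ − τ)·(a + b′(τ + στ)) = 0`
  have key : (σ τ - τ) * (a + b' * (τ + σ τ)) = 0 := by
    have h1 := hc
    rw [map_mul, hw, map_add, map_mul, ha, hb'] at h1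
    linear_combination h1
  have ha' : a = -(b' * (τ + σ τ)) := eq_neg_of_add_eq_zero_left ((mul_eq_zero.1 key).resolve_left hδ)
  have ham : a ∈ maximalIdeal S := by rw [ha']; exact neg_mem (Ideal.mul_mem_left _ _ (trace_mem_maximalIdeal σ hσ hτ))
  have hτm : τ ∈ maximalIdeal S := by rw [hmax]; exact Ideal.mem_span_singleton_self τ
  have hwm : w ∈ maximalIdeal S := by rw [hw]; exact add_mem ham (Ideal.mul_mem_left _ _ hτm)
  rw [sq]; exact Ideal.mul_mem_mul hwm hτm

include hσ hτ hbasis hd in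
/-- **FIXED ELEMENTS HAVE EVEN ORDER**: `σb = b ∧ b ∈ 𝔪^{2i+1} ⇒ b ∈ 𝔪^{2i+2}` (divide by the fixed generator `(τ·στ)^i` of `𝔪^{2i}` and use the previous lemma).  This is the lemma that makes
the wild case work without a skew uniformiser or `2 ∈ Sˣ` (★ tame `pow_succ_dvd_of_odd_pow_dvd_of_fixed` uses both). [cite: Serre1979, Ch. IV §1 Prop. 3] [cite: Flicker1998UnitaryFL, Prop. 7 p. 84] -/
theorem mem_pow_succ_of_fixed_of_mem_pow_odd {b : S} (hb : σ b = b) {i : ℕ} (h : b ∈ maximalIdeal S ^ (2 * i + 1)) : b ∈ maximalIdeal S ^ (2 * i + 2) := by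
  have hN : σ (τ * σ τ) = τ * σ τ := (map_add_map_self_eq σ hσ).2
  have hN0 : (τ * σ τ) ^ i ≠ 0 := pow_ne_zero _ (mul_ne_zero hτ.ne_zero (irreducible_map σ hσ hτ).ne_zero)
  -- `b = c · N^i` with `c ∈ 𝔪` fixed
  have h' : b ∈ maximalIdeal S * Ideal.span {(τ * σ τ) ^ i} := by rw [← maximalIdeal_pow_two_mul σ hσ hτ i, ← pow_succ']; exact h
  obtain ⟨c, hcm, rfl⟩ := Ideal.mem_mul_span_singleton.1 h'
  have hc : σ c = c := by
    have h1 := hb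
    rw [map_mul, map_pow, hN] at h1
    exact mul_right_cancel₀ hN0 h1
  have hc2 := mem_sq_of_fixed_of_mem σ hσ hτ hbasis hd hc hcm
  rw [show 2 * i + 2 = 2 * (i + 1) by ring, maximalIdeal_pow_two_mul σ hσ hτ (i + 1), pow_succ, Ideal.mem_span_singleton]
  rw [← span_mul_map_eq_sq σ hσ hτ, Ideal.mem_span_singleton] at hc2
  rw [mul_comm c]
  exact mul_dvd_mul_left _ hc2

include hτ in
/-- The constant coordinate of a UNIT is a unit: `IsUnit (a + bτ) → IsUnit a` (`bτ ∈ 𝔪`). [cite: Serre1979, Ch. I §6] -/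
theorem isUnit_of_isUnit_add_mul {a b : S} (h : IsUnit (a + b * τ)) : IsUnit a := by
  by_contra ha
  have ham : a ∈ maximalIdeal S := (IsLocalRing.mem_maximalIdeal _).2 ha
  have hτm : τ ∈ maximalIdeal S := by
    rw [(IsDiscreteValuationRing.irreducible_iff_uniformizer τ).1 hτ]; exact Ideal.mem_span_singleton_self τ
  exact (IsLocalRing.mem_maximalIdeal _).1 (add_mem ham (Ideal.mul_mem_left _ b hτm)) h

omit [IsDomain S] [IsDiscreteValuationRing S] in
include hσ in
/-- **THE PRODUCT IN THE EISENSTEIN BASIS**: `(a + bτ)(a′ + b′τ) = (aa′ − bb′·τστ) + (ab′ + a′b + bb′(τ + στ))·τ`, and the new coordinates are fixed when the old ones are.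
[cite: Serre1979, Ch. I §6 Prop. 18] -/
theorem coords_mul {x x' a b a' b' : S} (ha : σ a = a) (hb : σ b = b) (ha' : σ a' = a') (hb' : σ b' = b') (hx : x = a + b * τ) (hx' : x' = a' + b' * τ) :
    σ (a * a' - b * b' * (τ * σ τ)) = a * a' - b * b' * (τ * σ τ) ∧ σ (a * b' + a' * b + b * b' * (τ + σ τ)) = a * b' + a' * b + b * b' * (τ + σ τ) ∧
      x * x' = (a * a' - b * b' * (τ * σ τ)) + (a * b' + a' * b + b * b' * (τ + σ τ)) * τ := by
  obtain ⟨ht, hN⟩ := map_add_map_self_eq σ hσ (τ := τ)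
  refine ⟨by rw [map_sub, map_mul, map_mul, map_mul, ha, ha', hb, hb', hN], by rw [map_add, map_add, map_mul, map_mul, map_mul, map_mul, ha, ha', hb, hb', ht], ?_⟩
  rw [hx, hx']; ring

include hσ hτ in
/-- **THE COORDINATE RATIO IS ADDITIVE MODULO `𝔪^{2j+1}`**: for units `a, a′` and `b ∈ 𝔪^{2j}` (`b′` arbitrary), with `(A, B)` the coordinates of the product (`coords_mul`),
`B·A⁻¹ − (b·a⁻¹ + b′·a′⁻¹) ∈ 𝔪^{2j+1}` — after clearing the unit denominators the difference is `bb′·((τ + στ)aa′ + (ba′ + b′a)·τστ) ∈ 𝔪^{2j}·𝔪` (`τ + στ ∈ 𝔪`, `τστ ∈ 𝔪²`).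
(`Ring.inverse` as in ★ tame `twistedLog_mul_sub_mem`.) [cite: Serre1979, Ch. IV §1, Ch. V §1] [cite: Flicker1998UnitaryFL, Prop. 7 p. 84] -/
theorem ratio_mul_sub_add_mem {a b a' b' : S} (ha : IsUnit a) (ha' : IsUnit a') (j : ℕ) (hb : b ∈ maximalIdeal S ^ (2 * j)) :
    (a * b' + a' * b + b * b' * (τ + σ τ)) * Ring.inverse (a * a' - b * b' * (τ * σ τ)) - (b * Ring.inverse a + b' * Ring.inverse a') ∈
      maximalIdeal S ^ (2 * j + 1) := by
  have htm : τ + σ τ ∈ maximalIdeal S := trace_mem_maximalIdeal σ hσ hτ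
  have hNm : τ * σ τ ∈ maximalIdeal S := Ideal.mul_mem_left _ _ (map_uniformizer_mem_maximalIdeal σ hσ hτ)
  -- the denominator `P = aa′ − bb′N` is a unit
  have hP : IsUnit (a * a' - b * b' * (τ * σ τ)) := by
    by_contra hP
    have hPm := (IsLocalRing.mem_maximalIdeal _).2 hP
    have h2 : b * b' * (τ * σ τ) ∈ maximalIdeal S := Ideal.mul_mem_left _ _ hNm
    have : a * a' ∈ maximalIdeal S := by
      have := add_mem hPm h2; rwa [sub_add_cancel] at this
    exact (IsLocalRing.mem_maximalIdeal _).1 this (ha.mul ha')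
  -- the cleared numerator
  have hX : b * b' * ((τ + σ τ) * (a * a') + (b * a' + b' * a) * (τ * σ τ)) ∈ maximalIdeal S ^ (2 * j + 1) := by
    rw [pow_succ]
    exact Ideal.mul_mem_mul (Ideal.mul_mem_right _ _ hb) (add_mem (Ideal.mul_mem_right _ _ htm) (Ideal.mul_mem_left _ _ hNm))
  have e : (a * b' + a' * b + b * b' * (τ + σ τ)) * Ring.inverse (a * a' - b * b' * (τ * σ τ)) - (b * Ring.inverse a + b' * Ring.inverse a') =
      b * b' * ((τ + σ τ) * (a * a') + (b * a' + b' * a) * (τ * σ τ)) *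
        (Ring.inverse (a * a' - b * b' * (τ * σ τ)) * Ring.inverse a * Ring.inverse a') := by
    linear_combination (-((a * b' + a' * b + b * b' * (τ + σ τ)) * Ring.inverse (a * a' - b * b' * (τ * σ τ)))) * Ring.mul_inverse_cancel a ha +
      (-((a * b' + a' * b + b * b' * (τ + σ τ)) * Ring.inverse (a * a' - b * b' * (τ * σ τ)) * a * Ring.inverse a)) * Ring.mul_inverse_cancel a' ha' +
      ((b * a' + b' * a) * Ring.inverse a * Ring.inverse a') * Ring.mul_inverse_cancel _ hP +
      (b' * Ring.inverse a') * Ring.mul_inverse_cancel a ha + (b * Ring.inverse a) * Ring.mul_inverse_cancel a' ha'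
  rw [e]
  exact Ideal.mul_mem_right _ _ hX

end Structure

/-! ## §2 The graded step `[V_{d+2j} : V_{d+2j+2}] = |𝓀|` via the `τ`-coordinate ratio, and NO ODD STEPS -/

section Index

variable [IsDomain S] [IsDiscreteValuationRing S] (hσ : ∀ x, σ (σ x) = x) {τ : S} (hτ : Irreducible τ)
  (hbasis : ∀ x : S, ∃ a b : S, σ a = a ∧ σ b = b ∧ x = a + b * τ) {d : ℕ} (hd : Ideal.span {σ τ - τ} = maximalIdeal S ^ d)

include hσ hτ hbasis hd in
/-- **NO ODD STEPS**: `σu − u ∈ 𝔪^{d+2j+1} ↔ σu − u ∈ 𝔪^{d+2j+2}` for every `x ∈ S` (the `τ`-coordinate is fixed, hence of even order).  Tame `d = 1`: ★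
`map_sub_self_mem_pow_succ_of_even`. [cite: Serre1979, Ch. IV §1 Prop. 3] -/
theorem map_sub_self_mem_pow_add_odd_iff (j : ℕ) (x : S) :
    σ x - x ∈ maximalIdeal S ^ (d + (2 * j + 1)) ↔ σ x - x ∈ maximalIdeal S ^ (d + (2 * j + 2)) := by
  obtain ⟨a, b, ha, hb, hx⟩ := hbasis x
  rw [map_sub_self_mem_pow_add_iff σ hτ hd ha hb hx, map_sub_self_mem_pow_add_iff σ hτ hd ha hb hx]
  exact ⟨mem_pow_succ_of_fixed_of_mem_pow_odd σ hσ hτ hbasis hd hb, fun h => Ideal.pow_le_pow_right (by omega) h⟩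

include hτ hbasis hd in
/-- **LEVELS `≤ d` ARE EVERYTHING**: the subgroup `{u : σu ≡ u (𝔪^k)}` is all of `Sˣ` for `k ≤ d`; index `1`. [cite: Serre1979, Ch. IV §1 Prop. 4] [cite: Flicker1998UnitaryFL, Prop. 7 p. 84] -/
theorem index_comap_eqLocus_eq_one_of_le {k : ℕ} (hk : k ≤ d) :
    (((Units.map (Ideal.quotientMap (maximalIdeal S ^ k) σ (maximalIdeal_pow_le_comap σ hσ k)).toMonoidHom).eqLocus (MonoidHom.id _)).comap
        (Units.map (Ideal.Quotient.mk (maximalIdeal S ^ k)).toMonoidHom)).index = 1 := by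
  rw [Subgroup.index_eq_one, eq_top_iff]
  intro u _
  rw [mem_comap_eqLocus_iff σ hσ k u]
  exact Ideal.pow_le_pow_right hk (map_sub_self_mem_pow_different σ hτ hbasis hd u)

include hσ hτ hbasis hd in
/-- **THE GRADED STEP `[V_{d+2j} : V_{d+2j+2}] = |𝓀|`** (`V_k = {u ∈ Sˣ : σu ≡ u (𝔪^k)}` = ★'s `comap eqLocus` subgroup).  For `u = a + bτ ∈ V_{d+2j}` (`b ∈ 𝔪^{2j}`, `a` a unit) the
`τ`-COORDINATE RATIO `u ↦ b·a⁻¹ mod 𝔪^{2j+1}` is a homomorphism `V_{d+2j} → 𝔪^{2j} ∕ 𝔪^{2j+1}` (`ratio_mul_sub_add_mem`), ONTO (`1 + (τστ)^j r₀·τ`, `r₀` fixed) with KERNEL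
`{b ∈ 𝔪^{2j+1}} = {b ∈ 𝔪^{2j+2}} = V_{d+2j+2}` (fixed elements have even order).  Tame `d = 1`: ★ `relIndex_comap_eqLocus_odd` (there via the twisted logarithm and `2 ∈ Sˣ`).
[cite: Flicker1998UnitaryFL, Prop. 7 p. 84 and REMARK (Mars)] [cite: Serre1979, Ch. IV §1 Prop. 3, Ch. V §1] -/
theorem relIndex_comap_eqLocus_add_two [Finite (ResidueField S)] (j : ℕ) :
    (((Units.map (Ideal.quotientMap (maximalIdeal S ^ (d + (2 * j + 2))) σ (maximalIdeal_pow_le_comap σ hσ (d + (2 * j + 2)))).toMonoidHom).eqLocus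
          (MonoidHom.id _)).comap (Units.map (Ideal.Quotient.mk (maximalIdeal S ^ (d + (2 * j + 2)))).toMonoidHom)).relIndex
      (((Units.map (Ideal.quotientMap (maximalIdeal S ^ (d + 2 * j)) σ (maximalIdeal_pow_le_comap σ hσ (d + 2 * j))).toMonoidHom).eqLocus
          (MonoidHom.id _)).comap (Units.map (Ideal.Quotient.mk (maximalIdeal S ^ (d + 2 * j))).toMonoidHom)) = Nat.card (ResidueField S) := by
  classical
  set V₀ := (((Units.map (Ideal.quotientMap (maximalIdeal S ^ (d + 2 * j)) σ (maximalIdeal_pow_le_comap σ hσ (d + 2 * j))).toMonoidHom).eqLocus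
          (MonoidHom.id _)).comap (Units.map (Ideal.Quotient.mk (maximalIdeal S ^ (d + 2 * j))).toMonoidHom)) with hV₀
  set V₂ := (((Units.map (Ideal.quotientMap (maximalIdeal S ^ (d + (2 * j + 2))) σ (maximalIdeal_pow_le_comap σ hσ (d + (2 * j + 2)))).toMonoidHom).eqLocus
          (MonoidHom.id _)).comap (Units.map (Ideal.Quotient.mk (maximalIdeal S ^ (d + (2 * j + 2)))).toMonoidHom)) with hV₂
  have hmem₀ : ∀ u : Sˣ, u ∈ V₀ ↔ σ (u : S) - u ∈ maximalIdeal S ^ (d + 2 * j) := fun u => mem_comap_eqLocus_iff σ hσ _ u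
  have hmem₂ : ∀ u : Sˣ, u ∈ V₂ ↔ σ (u : S) - u ∈ maximalIdeal S ^ (d + (2 * j + 2)) := fun u => mem_comap_eqLocus_iff σ hσ _ u
  -- fixed data
  have hN : σ (τ * σ τ) = τ * σ τ := (map_add_map_self_eq σ hσ).2
  have hNm : τ * σ τ ∈ maximalIdeal S := Ideal.mul_mem_left _ _ (map_uniformizer_mem_maximalIdeal σ hσ hτ)
  have hτm : τ ∈ maximalIdeal S := by
    rw [(IsDiscreteValuationRing.irreducible_iff_uniformizer τ).1 hτ]; exact Ideal.mem_span_singleton_self τ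
  -- coordinates
  have hbasis' := hbasis
  choose A B hA hB hAB using hbasis'
  have hBmem : ∀ u : ↥V₀, B (u : Sˣ) ∈ maximalIdeal S ^ (2 * j) := fun u =>
    (map_sub_self_mem_pow_add_iff σ hτ hd (hA _) (hB _) (hAB _) (2 * j)).1 ((hmem₀ u).1 u.2)
  have hAu : ∀ u : Sˣ, IsUnit (A u) := fun u => isUnit_of_isUnit_add_mul hτ (by rw [← hAB]; exact Units.isUnit u)
  -- coordinates of `1` and of products
  have hA1 : A 1 = 1 ∧ B 1 = 0 := fixed_coords_unique' σ hτ hd (hA 1) (hB 1) (map_one σ) (map_zero σ) (by rw [← hAB, zero_mul, add_zero])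
  have hABmul : ∀ x y : S, A (x * y) = A x * A y - B x * B y * (τ * σ τ) ∧ B (x * y) = A x * B y + A y * B x + B x * B y * (τ + σ τ) := by
    intro x y
    obtain ⟨h1, h2, h3⟩ := coords_mul σ hσ (hA x) (hB x) (hA y) (hB y) (hAB x) (hAB y)
    exact fixed_coords_unique' σ hτ hd (hA _) (hB _) h1 h2 (by rw [← hAB]; exact h3)
  set I := maximalIdeal S ^ (2 * j + 1) with hI
  set K : Ideal (S ⧸ I) := (maximalIdeal S ^ (2 * j)).map (Ideal.Quotient.mk I) with hK
  have hw : ∀ u : ↥V₀, B (u : Sˣ) * Ring.inverse (A (u : Sˣ)) ∈ maximalIdeal S ^ (2 * j) := fun u => Ideal.mul_mem_right _ _ (hBmem u)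
  -- THE HOMOMORPHISM (closed term)
  obtain ⟨ψ, hψ⟩ : ∃ ψ : ↥V₀ →* Multiplicative ↥K, ∀ u : ↥V₀,
      ψ u = Multiplicative.ofAdd ⟨Ideal.Quotient.mk I (B (u : Sˣ) * Ring.inverse (A (u : Sˣ))), Ideal.mem_map_of_mem _ (hw u)⟩ := ⟨
    { toFun := fun u => Multiplicative.ofAdd ⟨Ideal.Quotient.mk I (B (u : Sˣ) * Ring.inverse (A (u : Sˣ))), Ideal.mem_map_of_mem _ (hw u)⟩
      map_one' := by
        change Multiplicative.ofAdd _ = Multiplicative.ofAdd 0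
        congr 1
        ext
        change Ideal.Quotient.mk I _ = 0
        rw [OneMemClass.coe_one, Units.val_one, hA1.2, zero_mul, map_zero]
      map_mul' := fun u u' => by
        change Multiplicative.ofAdd _ = Multiplicative.ofAdd (_ + _)
        congr 1
        ext
        change Ideal.Quotient.mk I _ = Ideal.Quotient.mk I _ + Ideal.Quotient.mk I _
        rw [← map_add, Ideal.Quotient.mk_eq_mk_iff_sub_mem, Subgroup.coe_mul, Units.val_mul, (hABmul _ _).1, (hABmul _ _).2]
        exact ratio_mul_sub_add_mem σ hσ hτ (hAu _) (hAu _) j (hBmem u) }, fun u => rfl⟩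
  -- KERNEL `= V₂ ⊓ V₀`
  have hker : ψ.ker = V₂.subgroupOf V₀ := by
    ext u
    rw [MonoidHom.mem_ker, Subgroup.mem_subgroupOf, hmem₂, hψ]
    change Multiplicative.ofAdd _ = Multiplicative.ofAdd 0 ↔ _
    rw [Multiplicative.ofAdd.injective.eq_iff, Subtype.ext_iff]
    change Ideal.Quotient.mk I _ = 0 ↔ _
    rw [Ideal.Quotient.eq_zero_iff_mem, Ideal.mul_unit_mem_iff_mem _ ((hAu _).ringInverse),
      map_sub_self_mem_pow_add_iff σ hτ hd (hA _) (hB _) (hAB _) (2 * j + 2)]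
    exact ⟨mem_pow_succ_of_fixed_of_mem_pow_odd σ hσ hτ hbasis hd (hB _), fun h => Ideal.pow_le_pow_right (by omega) h⟩
  -- ONTO
  have hsurj : Function.Surjective ψ := by
    intro z
    obtain ⟨m, hm, hmz⟩ := (Ideal.mem_map_iff_of_surjective (Ideal.Quotient.mk I) Ideal.Quotient.mk_surjective).1 (Multiplicative.toAdd z).2
    -- `m = r·N^j`, `r ≡ A r (mod 𝔪)`: the unit `1 + A r · N^j · τ`
    rw [maximalIdeal_pow_two_mul σ hσ hτ j, Ideal.mem_span_singleton'] at hm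
    obtain ⟨r, rfl⟩ := hm
    set c := A r * (τ * σ τ) ^ j with hc
    have hσc : σ c = c := by rw [hc, map_mul, map_pow, hA, hN]
    have hcm : c ∈ maximalIdeal S ^ (2 * j) := by
      rw [maximalIdeal_pow_two_mul σ hσ hτ j]; exact Ideal.mem_span_singleton'.2 ⟨A r, rfl⟩
    have hcτ : c * τ ∈ maximalIdeal S := Ideal.mul_mem_left _ _ hτm
    have hu : IsUnit (1 + c * τ) := by
      have := IsLocalRing.isUnit_one_sub_self_of_mem_nonunits (-(c * τ)) ((IsLocalRing.mem_maximalIdeal _).1 (neg_mem hcτ))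
      rwa [sub_neg_eq_add] at this
    have hcoord : A (1 + c * τ) = 1 ∧ B (1 + c * τ) = c := fixed_coords_unique' σ hτ hd (hA _) (hB _) (map_one σ) hσc (by rw [← hAB])
    have hmemV : hu.unit ∈ V₀ := by
      rw [hmem₀, IsUnit.unit_spec, map_sub_self_mem_pow_add_iff σ hτ hd (hA _) (hB _) (hAB _) (2 * j), hcoord.2]; exact hcm
    refine ⟨⟨hu.unit, hmemV⟩, ?_⟩
    apply Multiplicative.toAdd.injective
    rw [hψ]
    ext
    change Ideal.Quotient.mk I _ = ((Multiplicative.toAdd z : ↥K) : S ⧸ I)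
    rw [← hmz, Ideal.Quotient.mk_eq_mk_iff_sub_mem]
    simp only [IsUnit.unit_spec, hcoord.1, hcoord.2, Ring.inverse_one, mul_one]
    -- `c − r·N^j = −(B r)·N^j·τ ∈ 𝔪^{2j}·𝔪`
    have hr : r = A r + B r * τ := hAB r
    rw [show c - r * (τ * σ τ) ^ j = -(B r * τ * (τ * σ τ) ^ j) by rw [hc]; nth_rewrite 2 [hr]; ring, neg_mem_iff, hI, pow_succ',
      maximalIdeal_pow_two_mul σ hσ hτ j]
    exact Ideal.mul_mem_mul (Ideal.mul_mem_left _ _ hτm) (Ideal.mem_span_singleton_self _)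
  have h1 := Subgroup.index_ker ψ
  rw [hker, MonoidHom.range_eq_top_of_surjective _ hsurj, Subgroup.card_top] at h1
  rw [Subgroup.relIndex, h1]
  exact (Nat.card_congr Multiplicative.toAdd).trans (natCard_map_mk_maximalIdeal_pow (2 * j))

/-! ## §3 The index `[Sˣ : V_{d+2j}] = q^j` (HEAD), odd levels, and the tame corollary -/

include hσ hτ hbasis hd in
/-- **ABSTRACT WILD MARS INDEX (HEAD): `[Sˣ : {u : σu ≡ u (𝔪^{d+2j})}] = q^j`** for a DVR `S` with involution `σ`, an Eisenstein basis `S = S^σ ⊕ S^σ·τ` over the fixed ring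
(`τ` a uniformiser) and different `(στ − τ) = 𝔪^d` — ANY residue characteristic, no skew uniformiser, no `2 ∈ Sˣ`.  In coordinates the subgroup is the unit group of the
conductor-`j` order `S^σ + (τστ)^j S` (`map_sub_self_mem_pow_add_iff`), so this is Mars' `[R_E^× : R_E(j)^×] = q^{j+1−f}(q^f − 1)∕(q − 1) = q^j` (`e = 2`, `f = 1`) for a
WILDLY ramified `E ∕ F` as well [Flicker1998UnitaryFL §6 p. 95 REMARK]; induction on `j` via the graded step `relIndex_comap_eqLocus_add_two` and `Subgroup.relIndex_mul_index`,
base `index_comap_eqLocus_eq_one_of_le`.  STRICT GENERALISATION of ★ `index_comap_eqLocus_odd_eq_pow` (tame: `d = 1`, see `index_comap_eqLocus_odd_eq_pow'` below); the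
CM-place instance (`S = 𝒪_{L_w}`, valuation letters) is ★ `RamifiedPlaceOrderUnitIndex.relIndex_eq_pow_of_sigmaDepth`; the intended new reader is a wildly ramified rank-2
splitting field `K₂ ∕ L_w` with its own `σ` (not a CM place). [cite: Flicker1998UnitaryFL, Prop. 7 p. 84; §6 p. 95 REMARK (Mars)] [cite: Serre1979, Ch. IV §1 Prop. 3–4, Ch. V §1] -/
theorem index_comap_eqLocus_add_two_mul_eq_pow [Finite (ResidueField S)] {q : ℕ} (hq : Nat.card (ResidueField S) = q) (j : ℕ) :
    (((Units.map (Ideal.quotientMap (maximalIdeal S ^ (d + 2 * j)) σ (maximalIdeal_pow_le_comap σ hσ (d + 2 * j))).toMonoidHom).eqLocus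
          (MonoidHom.id _)).comap (Units.map (Ideal.Quotient.mk (maximalIdeal S ^ (d + 2 * j))).toMonoidHom)).index = q ^ j := by
  induction j with
  | zero =>
    rw [show d + 2 * 0 = d by ring, pow_zero]
    exact index_comap_eqLocus_eq_one_of_le σ hσ hτ hbasis hd le_rfl
  | succ j ih =>
    have hle : (((Units.map (Ideal.quotientMap (maximalIdeal S ^ (d + 2 * (j + 1))) σ (maximalIdeal_pow_le_comap σ hσ (d + 2 * (j + 1)))).toMonoidHom).eqLocus
          (MonoidHom.id _)).comap (Units.map (Ideal.Quotient.mk (maximalIdeal S ^ (d + 2 * (j + 1)))).toMonoidHom)) ≤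
        (((Units.map (Ideal.quotientMap (maximalIdeal S ^ (d + 2 * j)) σ (maximalIdeal_pow_le_comap σ hσ (d + 2 * j))).toMonoidHom).eqLocus
          (MonoidHom.id _)).comap (Units.map (Ideal.Quotient.mk (maximalIdeal S ^ (d + 2 * j))).toMonoidHom)) := by
      intro u hu
      rw [mem_comap_eqLocus_iff σ hσ] at hu ⊢
      exact Ideal.pow_le_pow_right (by omega) hu
    have h := Subgroup.relIndex_mul_index hle
    rw [ih, show d + 2 * (j + 1) = d + (2 * j + 2) by ring, relIndex_comap_eqLocus_add_two σ hσ hτ hbasis hd j, hq] at h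
    rw [show d + 2 * (j + 1) = d + (2 * j + 2) by ring, ← h, pow_succ, mul_comm]

include hσ hτ hbasis hd in
/-- **ODD LEVELS**: `[Sˣ : {σu ≡ u (𝔪^{d+2j+1})}] = q^{j+1}` — the level-`(d+2j+1)` subgroup equals the level-`(d+2j+2)` one (NO ODD STEPS, `map_sub_self_mem_pow_add_odd_iff`), so
`[Sˣ : {σu ≡ u (𝔪^n)}] = q^⌈(n−d)∕2⌉` for every `n ≥ d` (and `= 1` for `n ≤ d`). [cite: Serre1979, Ch. IV §1 Prop. 3, Ch. V §1] [cite: Flicker1998UnitaryFL, Prop. 7 p. 84] -/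
theorem index_comap_eqLocus_add_odd_eq_pow [Finite (ResidueField S)] {q : ℕ} (hq : Nat.card (ResidueField S) = q) (j : ℕ) :
    (((Units.map (Ideal.quotientMap (maximalIdeal S ^ (d + (2 * j + 1))) σ (maximalIdeal_pow_le_comap σ hσ (d + (2 * j + 1)))).toMonoidHom).eqLocus
          (MonoidHom.id _)).comap (Units.map (Ideal.Quotient.mk (maximalIdeal S ^ (d + (2 * j + 1)))).toMonoidHom)).index = q ^ (j + 1) := by
  have heq : (((Units.map (Ideal.quotientMap (maximalIdeal S ^ (d + (2 * j + 1))) σ (maximalIdeal_pow_le_comap σ hσ (d + (2 * j + 1)))).toMonoidHom).eqLocus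
          (MonoidHom.id _)).comap (Units.map (Ideal.Quotient.mk (maximalIdeal S ^ (d + (2 * j + 1)))).toMonoidHom)) =
      (((Units.map (Ideal.quotientMap (maximalIdeal S ^ (d + 2 * (j + 1))) σ (maximalIdeal_pow_le_comap σ hσ (d + 2 * (j + 1)))).toMonoidHom).eqLocus
          (MonoidHom.id _)).comap (Units.map (Ideal.Quotient.mk (maximalIdeal S ^ (d + 2 * (j + 1)))).toMonoidHom)) := by
    ext u
    rw [mem_comap_eqLocus_iff σ hσ, mem_comap_eqLocus_iff σ hσ, map_sub_self_mem_pow_add_odd_iff σ hσ hτ hbasis hd j, show d + 2 * (j + 1) = d + (2 * j + 2) by ring]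
  rw [heq]
  exact index_comap_eqLocus_add_two_mul_eq_pow σ hσ hτ hbasis hd hq (j + 1)

include hσ in
/-- **THE TAME CASE DROPS OUT** (strict generalisation check): under ★ `RamifiedQuadraticOrderUnitIndex`'s hypotheses — `σ` residually trivial, an ANTI-FIXED uniformiser
`σϖ = −ϖ`, `2 ∈ Sˣ` — the Eisenstein-basis hypothesis is ★ `exists_fixed_add_fixed_mul` and the different is `(σϖ − ϖ) = (−2ϖ) = 𝔪¹`, so the HEAD with `d = 1` re-derives ★
`index_comap_eqLocus_odd_eq_pow`: `[Sˣ : {σu ≡ u (𝔪^{2j+1})}] = q^j`. [cite: Flicker1998UnitaryFL, Prop. 7 p. 84] [cite: Serre1979, Ch. IV §1 Prop. 3] -/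
theorem index_comap_eqLocus_odd_eq_pow' (hres : ∀ x, σ x - x ∈ maximalIdeal S) {ϖ : S} (hϖ : Irreducible ϖ) (hσϖ : σ ϖ = -ϖ) (h2 : IsUnit (2 : S))
    [Finite (ResidueField S)] {q : ℕ} (hq : Nat.card (ResidueField S) = q) (j : ℕ) :
    (((Units.map (Ideal.quotientMap (maximalIdeal S ^ (2 * j + 1)) σ (maximalIdeal_pow_le_comap σ hσ (2 * j + 1))).toMonoidHom).eqLocus
          (MonoidHom.id _)).comap (Units.map (Ideal.Quotient.mk (maximalIdeal S ^ (2 * j + 1))).toMonoidHom)).index = q ^ j := by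
  have hbasis' : ∀ x : S, ∃ a b : S, σ a = a ∧ σ b = b ∧ x = a + b * ϖ := exists_fixed_add_fixed_mul σ hσ hres hϖ hσϖ h2
  have hd' : Ideal.span {σ ϖ - ϖ} = maximalIdeal S ^ 1 := by
    rw [pow_one, (IsDiscreteValuationRing.irreducible_iff_uniformizer ϖ).1 hϖ, hσϖ, show -ϖ - ϖ = ϖ * (-2) by ring, Ideal.span_singleton_mul_right_unit h2.neg]
  rw [show 2 * j + 1 = 1 + 2 * j by ring]
  exact index_comap_eqLocus_add_two_mul_eq_pow σ hσ hϖ hbasis' hd' hq j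

end Index

end Literature.NumberTheory.LocalFields.RamifiedQuadraticOrder
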